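import Mathlib.Algebra.CharP.Two
import Mathlib.Tactic.Ring
import Mathlib.Tactic.LinearCombination
import HarnessLib

/-!
# Abramovich–Temkin 2026: inseparable and wild umbrellas in characteristic `2` — the explicit transforms

Topic `Literature/AlgebraicGeometry/Resolution`; rung X1 (kangaroo / residual phenomena) × LIT-4 (weighted
resolution) of the `res-hironaka` campaign.  Source, read on the page: D. Abramovich, M. Temkin, *Partial
desingularization up to normal-crossings in characteristic 0 and 2*, arXiv:2602.15612 **v3** (6 July 2026)
[cite: AbramovichTemkin2026] (PDF page = printed page; NB the earlier versions v1/v2 of the same arXiv number do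
NOT contain §2 or Theorem 1.4.1), §2.2 "Inseparable umbrellas in characteristic 2" (pp. 6–7) and §2.3 "Wild
umbrellas in characteristic 2" (pp. 7–10); the inseparable umbrella is Włodarczyk's example as reported in
M. Temkin, *Dream resolution and principalization I*, arXiv:2503.18205, §1.2.2 warning (1) [cite: Temkin2025].

This file types the EXPLICIT POLYNOMIAL IDENTITIES printed there, as theorems over an arbitrary commutative
ring (or a commutative ring of characteristic `2` where the text uses `char(k) = 2`), in the style of
`Literature.AlgebraicGeometry.Resolution.Hauser2010` (`exampleK0_blowup` …): elements `x y z : A`, identities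
by `ring`.  Nothing is asserted as a fact; no stack, no invariant and no resolution statement is formalised —
the sentences about invariants, tame stacks and NC-preserving resolutions (Thm. 1.4.1, Prop. 2.3.6, §2.2.2
(1)–(3)) are QUOTED in docstrings only, with locators, for the barrier catalogue (candidate entry
«WeightedPPinchLoop», kill test K4.3 of the campaign) to cite.

* `wildUmbrella n x y z = x² + y²z + x y zⁿ` — "Definition 1.5.1. Fix an integer `n ≥ 1`. The `n`-th wild
  umbrella is the surface `Xₙ ⊂ 𝔸³` given by (3) `x² + y²z + xyzⁿ = 0`" (p. 3 l. 35–38); "the singular locus is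
  the `z`-axis `C = V(x, y)`, but this time the quadratic form is non-degenerate at any point of `C₀ = C ∖ {p}`,
  so similarly to the usual Whitney umbrella there is a pinch point at the origin and all other singularities
  are normal crossings singularities" (p. 8 l. 1–4).  `inseparableUmbrella x y z = x² + y²z` is the `n`-free
  part ("The same formula `X = V(x² + y²z)` defines a surface whose singular locus `C = V(x, y)` is not
  generically normal crossings … In a sense the whole `C` consists of inseparable pinch points", p. 6 l. 36–40);
  its `G_a`-equisingularity `a(x, y, z) = (x + ay, y, z + a²)` (p. 6 l. 38–39) is `inseparableUmbrella_translate`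
  (the case `p = 2` of the tree's `WeightedBlowup.Umbrella.translate_along_line` in
  `WeightedBlowupUmbrella.lean`, which states the translation homogeneity of `x^p + Y Z^p` for every `p`).
* POINT BLOW-UP PERSISTS (§2.3.3 p. 8 l. 5–8): "The equations `f(x, y, z) = x² + y²z + xyzⁿ` are homogeneous of
  degree `2` in `x, y`, hence … after blowing up the origin the strict transform in the `z`-chart is given by
  the same polynomial" — `wildUmbrella_pointBlowup_zChart` : `f(xz, yz, z) = z² · f(x, y, z)` (any ring).
* THE WEIGHTED STEP, Eq. (4) (§2.3.3 p. 8 l. 10–18): for "the weighted blowing up associated to the center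
  `(x², y³, z³)`" one uses "the degeneration to the normal cone `x = s³x′, y = s²y′, z = s²z′`. The proper
  transform of `f(x, y, z)` is (4) `x′² + y′²z′ + s^{2n−1}x′y′z′ⁿ`. These are equisingular along `V(s, x′, y′)`,
  but this locus does not support a center of weighted blowup" — `wildUmbrella_weightedTransform` :
  `f(s³x′, s²y′, s²z′) = s⁶ · (x′² + y′²z′ + s^{2n−1}x′y′z′ⁿ)` (any ring; stated with `n = m + 1`); and for the
  inseparable umbrella (§2.2.2 p. 7 l. 10–14) "the proper transform has equation `x′² = y′²z′`" —
  `inseparableUmbrella_weightedTransform` : `(s³x′)² + (s²y′)²(s²z′) = s⁶ · (x′² + y′²z′)`: the equation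
  REPRODUCES ITSELF one dimension up.  (The printed conclusions "(2) unlike the characteristic 0 case, the
  invariant does not drop on blowing up … (3) … there are no étale charts to use here, and flat charts which
  are not smooth are useless" (p. 7 l. 18–25) concern the `𝔾_m`-quotient `[{x′² = y′²z′}/𝔾_m]` and are NOT
  formalised; the kernel computation of the transplanted invariant at the `μ₂`-point is the row
  `KangarooAtlasCertWeighted.whitney_loop`.)
* BLOWING UP THE SINGULAR LINE `V(x, y)` (p. 8 l. 8–9: "Of course the blowup of the singular locus `V(x, y)`
  resolves the singularities, but is not NC-preserving"; §2.3.7 p. 9: "Normalization is given by `w = x/y` so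
  that `w² + wzⁿ + z`, a regular surface"): `wildUmbrella_lineBlowup_yChart` : `f(wy, y, z) = y² · (w² + wzⁿ + z)`
  and `wildUmbrella_lineBlowup_xChart` : `f(x, vx, z) = x² · (1 + v²z + vzⁿ)` (any ring).
* THE NON-TAME `ℤ/2`-COVER, Eq. (5) (§2.3.8 p. 9 l. 30 – p. 10 l. 4, characteristic `2`): with
  `T = Spec k[w′, y₁, y₂, z]/(w′² + zⁿw′ + z, y₁y₂)` and the map `(x, y, z) ↦ (w′(y₁ + y₂) + zⁿy₂, y₁ + y₂, z)`,
  "As a sanity check note that (5) `x² + xyzⁿ + y²z = … = z^{2n}y₁y₂ = 0`, using `y₁y₂ = 0` and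
  `w′² + zⁿw′ = z`" — `wildUmbrella_cover_eq` (the identity `= z^{2n}y₁y₂` from the first relation, char `2`)
  and `wildUmbrella_cover_eq_zero`.

* FOR CONTRAST, the classical umbrella `x² − y²z` (§2.1, `char(k) ≠ 2` in the source; the identities hold in
  any ring): the point blow-up persists (§2.1.2 p. 4 l. 11–16), Kollár's `W = V(x² − yzt) ⊂ 𝔸⁴` persists
  likewise (§2.1.4 p. 4 l. 28–33, citing [Kol07, Ex. 3.6.2]), while the weighted blow-up with centre
  `(x², y³, z³)` read on the `μ₂`-chart `x′ = x/z′³, y′ = y/z′², z = z′²` gives `z′⁶(x′² − y′²)`, a normal crossings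
  equation (§2.1.9 p. 5 l. 30–40) — whereas for the inseparable umbrella the same slice `{z′ = 1}` shows
  `x′² + y′² = (x′ + y′)²` in characteristic `2`, "misleading" per §2.2.2 (3) (`inseparableUmbrella_flatSlice`,
  `inseparableUmbrella_flatSlice_charTwo`).

What the source proves and this file does NOT formalise (quoted for the catalogue): **Theorem 1.4.1** (p. 3
l. 18–24) "(1) Let `X` be a surface in any characteristic with at most normal crossings and pinch points. Then
`X` is the coarse moduli space of a normal-crossings stack `𝒳`, where `𝒳 → X` is an isomorphism away from the
pinch points, with `ℤ/2ℤ` as stabilizers at all pinch points. (2) If `char(k) = 2` and `X` has at least one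
pinch point, then no sequence of weighted blowups gives a NC-preserving stack-theoretic resolution of `X`.",
proved as Prop. 2.3.6 (p. 8) for TAME stack modifications that are isomorphisms off the pinch point — a
statement about NC-PRESERVING resolutions of the WILD pinch points `Xₙ`, not about resolving them (p. 8
l. 8–9 above).  AI transcription; AI review is weaker than expert review.
-/

namespace Literature.AlgebraicGeometry.Resolution

namespace WildUmbrella

variable {A : Type*} [CommRing A]

/-! ## The equations -/

/-- The INSEPARABLE umbrella `x² + y²z` (Włodarczyk's example; in characteristic `2` "the whole `C = V(x, y)`
consists of inseparable pinch points"). [cite: AbramovichTemkin2026, §2.2.1 (p. 6 l. 36–40)]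
[cite: Temkin2025, §1.2.2 warning (1)] -/
def inseparableUmbrella (x y z : A) : A := x ^ 2 + y ^ 2 * z

/-- The `n`-th WILD umbrella `Xₙ = V(x² + y²z + xyzⁿ)`, `n ≥ 1` ("a sequence of distinct relevant pinch
points", characteristic `2`). [cite: AbramovichTemkin2026, Def. 1.5.1, Eq. (3) (p. 3 l. 35–38)] -/
def wildUmbrella (n : ℕ) (x y z : A) : A := x ^ 2 + y ^ 2 * z + x * y * z ^ n

/-- The wild umbrella is the inseparable umbrella plus the cross term `xyzⁿ` (Eq. (3) vs. the equation of
§2.2.1). (derived here) [cite: AbramovichTemkin2026, Def. 1.5.1, Eq. (3) (p. 3) and §2.2.1 (p. 6)] -/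
theorem wildUmbrella_eq (n : ℕ) (x y z : A) :
    wildUmbrella n x y z = inseparableUmbrella x y z + x * y * z ^ n := rfl

/-- The wild umbrella vanishes on the `z`-axis `C = V(x, y)` ("the singular locus is the `z`-axis").
[cite: AbramovichTemkin2026, §2.3.2 (p. 8 l. 1–4)] -/
theorem wildUmbrella_zAxis (n : ℕ) (z : A) : wildUmbrella n 0 0 z = 0 := by
  unfold wildUmbrella; ring

/-- `G_a`-EQUISINGULARITY of the inseparable umbrella along `C` in characteristic `2`: "there exists a `G_a`
action on `X` which induces the usual additive action on `C`. It is defined by `a(x, y, z) = (x + ay, y, z + a²)`"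
— the equation is invariant on the nose (the case `p = 2`, `Y = z`, `Z = y` of the translation homogeneity
`WeightedBlowup.Umbrella.translate_along_line` of `x^p + Y Z^p`).
[cite: AbramovichTemkin2026, §2.2.1 (p. 6 l. 37–39)] -/
theorem inseparableUmbrella_translate [CharP A 2] (x y z a : A) :
    inseparableUmbrella (x + a * y) y (z + a ^ 2) = inseparableUmbrella x y z := by
  unfold inseparableUmbrella
  linear_combination (a ^ 2 * y ^ 2 + x * a * y) * (CharTwo.two_eq_zero : (2 : A) = 0)

/-- Consequently every point `(0, 0, b²)` of the `z`-axis is carried to the origin by an automorphism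
preserving the equation: `f(x + by, y, z + b²) = f(x, y, z)` ("In a sense the whole `C` consists of
inseparable pinch points"; over a perfect field every closed point of `C` is of this form).
(derived here) [cite: AbramovichTemkin2026, §2.2.1 (p. 6 l. 39–40)] -/
theorem inseparableUmbrella_translate_sq [CharP A 2] (x y z b : A) :
    inseparableUmbrella (x + b * y) y (z + b ^ 2) = inseparableUmbrella x y z :=
  inseparableUmbrella_translate x y z b

/-! ## Point blow-up: the singularity persists -/

/-- POINT BLOW-UP, `z`-chart `(x, y, z) ↦ (xz, yz, z)`: the total transform of `Xₙ` is `z² · Xₙ` — "after blowing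
up the origin the strict transform in the `z`-chart is given by the same polynomial
`f(x′, y′, z) = x′² + y′²z + x′y′zⁿ`" (any commutative ring).
[cite: AbramovichTemkin2026, §2.3.3 (p. 8 l. 5–8)] -/
theorem wildUmbrella_pointBlowup_zChart (n : ℕ) (x y z : A) :
    wildUmbrella n (x * z) (y * z) z = z ^ 2 * wildUmbrella n x y z := by
  unfold wildUmbrella; ring

/-- The same for the inseparable umbrella (the classical computation of §2.1.2, sign-free).
[cite: AbramovichTemkin2026, §2.1.2 (p. 4 l. 11–16) and §2.2.1] -/
theorem inseparableUmbrella_pointBlowup_zChart (x y z : A) :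
    inseparableUmbrella (x * z) (y * z) z = z ^ 2 * inseparableUmbrella x y z := by
  unfold inseparableUmbrella; ring

/-! ## The weighted step with centre `(x², y³, z³)`: degeneration to the normal cone `x = s³x′, y = s²y′, z = s²z′` -/

/-- **Eq. (4).** For the centre `(x², y³, z³)` (weights `(3, 2, 2)`, "easily seen to be the weighted
`I_X`-admissible center of maximal possible multiorder") the total transform of `X_{m+1}` under
`x = s³x′, y = s²y′, z = s²z′` is `s⁶ · (x′² + y′²z′ + s^{2m+1} x′y′z′^{m+1})`, i.e. the proper transform is
"(4) `x′² + y′²z′ + s^{2n−1}x′y′z′ⁿ`" with `n = m + 1` ("These are equisingular along `V(s, x′, y′)`, but this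
locus does not support a center of weighted blowup") (any commutative ring).
[cite: AbramovichTemkin2026, §2.3.3, Eq. (4) (p. 8 l. 10–18)] -/
theorem wildUmbrella_weightedTransform (m : ℕ) (s x y z : A) :
    wildUmbrella (m + 1) (s ^ 3 * x) (s ^ 2 * y) (s ^ 2 * z) =
      s ^ 6 * (x ^ 2 + y ^ 2 * z + s ^ (2 * m + 1) * x * y * z ^ (m + 1)) := by
  unfold wildUmbrella; ring

/-- **The p-pinch loop, ring-level.** For the inseparable umbrella the same degeneration gives
`s⁶ · (x′² + y′²z′)`: "the proper transform has equation `x′² = y′²z′`" — the equation reproduces itself one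
dimension up (any commutative ring; the printed consequences "(2) unlike the characteristic 0 case, the
invariant does not drop on blowing up … (3) … flat charts which are not smooth are useless … the invariant
`(2)` of `T := {x′² = y′²}` is larger than the invariant `(2, 3, 3)` of `𝒵 := [{x′² = y′²z′}/𝔾_m]`" concern the
`𝔾_m`-quotient and are not formalised; kernel row of the invariant: `KangarooAtlasCertWeighted.whitney_loop`).
[cite: AbramovichTemkin2026, §2.2.2 (p. 7 l. 10–25)] -/
theorem inseparableUmbrella_weightedTransform (s x y z : A) :
    inseparableUmbrella (s ^ 3 * x) (s ^ 2 * y) (s ^ 2 * z) = s ^ 6 * inseparableUmbrella x y z := by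
  unfold inseparableUmbrella; ring

/-- Eq. (4) rewritten: the proper transform of `X_{m+1}` is the inseparable umbrella in `(x′, y′, z′)` plus
`s^{2m+1} x′y′z′^{m+1}`; on the exceptional divisor `{s = 0}` only the inseparable umbrella survives.
(derived here) [cite: AbramovichTemkin2026, §2.3.3, Eq. (4) (p. 8 l. 15–18)] -/
theorem wildUmbrella_weightedTransform_eq (m : ℕ) (s x y z : A) :
    wildUmbrella (m + 1) (s ^ 3 * x) (s ^ 2 * y) (s ^ 2 * z) =
      s ^ 6 * (inseparableUmbrella x y z + s ^ (2 * m + 1) * x * y * z ^ (m + 1)) := by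
  unfold wildUmbrella inseparableUmbrella; ring

/-- On the exceptional divisor `s = 0` of the degeneration the proper transform `(4)` restricts to the
inseparable umbrella `x′² + y′²z′`. (derived here) [cite: AbramovichTemkin2026, §2.3.3, Eq. (4) (p. 8)] -/
theorem wildUmbrella_properTransform_excDivisor (m : ℕ) (x y z : A) :
    x ^ 2 + y ^ 2 * z + (0 : A) ^ (2 * m + 1) * x * y * z ^ (m + 1) = inseparableUmbrella x y z := by
  unfold inseparableUmbrella
  rw [zero_pow (by omega)]
  ring

/-! ## Blowing up the singular line `V(x, y)` -/

/-- LINE BLOW-UP, chart `x = wy`: `f(wy, y, z) = y² · (w² + wzⁿ + z)`; the strict transform `w² + wzⁿ + z` is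
the printed normalization ("Normalization is given by `w = x/y` so that `w² + wzⁿ + z`, a regular surface with
conductor given by `y = 0`"; "the blowup of the singular locus `V(x, y)` resolves the singularities, but is not
NC-preserving") (any commutative ring).
[cite: AbramovichTemkin2026, §2.3.7 (p. 9 l. 29–32) and §2.3.3 (p. 8 l. 8–9)] -/
theorem wildUmbrella_lineBlowup_yChart (n : ℕ) (w y z : A) :
    wildUmbrella n (w * y) y z = y ^ 2 * (w ^ 2 + w * z ^ n + z) := by
  unfold wildUmbrella; ring

/-- LINE BLOW-UP, chart `y = vx`: `f(x, vx, z) = x² · (1 + v²z + vzⁿ)` (the strict transform is a unit at the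
origin of this chart) (any commutative ring). (derived here)
[cite: AbramovichTemkin2026, §2.3.3 (p. 8 l. 8–9)] -/
theorem wildUmbrella_lineBlowup_xChart (n : ℕ) (x v z : A) :
    wildUmbrella n x (v * x) z = x ^ 2 * (1 + v ^ 2 * z + v * z ^ n) := by
  unfold wildUmbrella; ring

/-- The inseparable umbrella under the same chart `x = wy`: `y² · (w² + z)`, the case `p = 2` of the tree's
`WeightedBlowup.Umbrella` (U2) ("one blow-up of the line resolves"). (derived here)
[cite: AbramovichTemkin2026, §2.2.1 (p. 7 l. 2: "The maximal locus here is the z-axis, which is indeed a good blow-up center")] -/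
theorem inseparableUmbrella_lineBlowup_yChart (w y z : A) :
    inseparableUmbrella (w * y) y z = y ^ 2 * (w ^ 2 + z) := by
  unfold inseparableUmbrella; ring

/-! ## The non-tame `ℤ/2`-cover `T → Xₙ`, Eq. (5) (characteristic `2`) -/

/-- **Eq. (5), sanity identity of the cover** `T = Spec k[w′, y₁, y₂, z]/(w′² + zⁿw′ + z, y₁y₂) → Xₙ`,
`(x, y, z) ↦ (w′(y₁ + y₂) + zⁿy₂, y₁ + y₂, z)`: in characteristic `2`, using only the relation
`w′² + zⁿw′ + z = 0`, one has `x² + xyzⁿ + y²z = z^{2n} y₁y₂` ("As a sanity check note that (5) … using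
`y₁y₂ = 0` and `w′² + zⁿw′ = z`").
[cite: AbramovichTemkin2026, §2.3.8, Eq. (5) (p. 9 l. 30 – p. 10 l. 4)] -/
theorem wildUmbrella_cover_eq [CharP A 2] (n : ℕ) (w y₁ y₂ z : A) (hw : w ^ 2 + z ^ n * w + z = 0) :
    wildUmbrella n (w * (y₁ + y₂) + z ^ n * y₂) (y₁ + y₂) z = z ^ (2 * n) * y₁ * y₂ := by
  unfold wildUmbrella
  linear_combination (y₁ + y₂) ^ 2 * hw +
    (w * (y₁ + y₂) * z ^ n * y₂ + z ^ (2 * n) * y₂ ^ 2) * (CharTwo.two_eq_zero : (2 : A) = 0)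

/-- Hence on `T` (where also `y₁y₂ = 0`) the pull-back of the equation of `Xₙ` vanishes: the map `T → Xₙ` is
well defined ("`= z^{2n}y₁y₂ = 0`"). [cite: AbramovichTemkin2026, §2.3.8, Eq. (5) (p. 10 l. 1–4)] -/
theorem wildUmbrella_cover_eq_zero [CharP A 2] (n : ℕ) (w y₁ y₂ z : A) (hw : w ^ 2 + z ^ n * w + z = 0)
    (hy : y₁ * y₂ = 0) : wildUmbrella n (w * (y₁ + y₂) + z ^ n * y₂) (y₁ + y₂) z = 0 := by
  rw [wildUmbrella_cover_eq n w y₁ y₂ z hw, mul_assoc, hy, mul_zero]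

/-- On each component `Tᵢ = V(yᵢ)` the cover map is the normalization chart: e.g. on `y₂ = 0` it reads
`(x, y, z) = (w y₁, y₁, z)` with `w² + zⁿw + z = 0`, i.e. the strict transform `w² + wzⁿ + z` of the line blow-up
("on each component `Tᵢ = V(yᵢ)` the map `Tᵢ → X` factors through an isomorphism with the normalization";
"on the normalization `T̃` of `T` one has `w′ = w` on the locus `y₂ = 0` and `w′ = w + zⁿ` on the locus
`y₁ = 0`"). (derived here) [cite: AbramovichTemkin2026, §2.3.8 (p. 9 l. 40–42, p. 10 l. 5–6)] -/
theorem wildUmbrella_cover_component (n : ℕ) (w y₁ z : A) :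
    wildUmbrella n (w * (y₁ + 0) + z ^ n * 0) (y₁ + 0) z = y₁ ^ 2 * (w ^ 2 + w * z ^ n + z) := by
  unfold wildUmbrella; ring

/-- The involution of the cover, `(w′, y₁, y₂, z) ↦ (w′ + zⁿ, y₂, y₁, z)`, preserves the relation
`w′² + zⁿw′ + z` in characteristic `2` (so it acts on `T`). (derived here)
[cite: AbramovichTemkin2026, §2.3.8 (p. 9 l. 36–37)] -/
theorem cover_relation_involution [CharP A 2] (n : ℕ) (w z : A) :
    (w + z ^ n) ^ 2 + z ^ n * (w + z ^ n) + z = w ^ 2 + z ^ n * w + z := by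
  linear_combination (w * z ^ n + z ^ (2 * n)) * (CharTwo.two_eq_zero : (2 : A) = 0)

/-- … and fixes the map to `Xₙ`: the image point `(w′(y₁ + y₂) + zⁿy₂, y₁ + y₂, z)` is unchanged under the
involution, in characteristic `2`. (derived here) [cite: AbramovichTemkin2026, §2.3.8 (p. 9 l. 36–39)] -/
theorem cover_map_involution [CharP A 2] (n : ℕ) (w y₁ y₂ z : A) :
    (w + z ^ n) * (y₂ + y₁) + z ^ n * y₁ = w * (y₁ + y₂) + z ^ n * y₂ := by
  linear_combination (z ^ n * y₁) * (CharTwo.two_eq_zero : (2 : A) = 0)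

/-! ## For contrast: the classical umbrella `x² − y²z` and Kollár's `x² − yzt` (§2.1; any ring) -/

/-- The CLASSICAL Whitney umbrella `x² − y²z` ("(2) `x² − y²z = 0` … known as Whitney's umbrella").
[cite: AbramovichTemkin2026, §1.2, Eq. (2) (p. 2) and §2.1.1 (p. 4)] -/
def classicalUmbrella (x y z : A) : A := x ^ 2 - y ^ 2 * z

/-- §2.1.2 "The singularity is not improved under a standard blowup": in the `z`-chart `x′ = x/z, y′ = y/z`
"the full pullback is `V(z²(x′² − y′²z))` and the strict transform is `X′ = V(x′² − y′²z)`, which is precisely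
the same Whitney umbrella" (any commutative ring). [cite: AbramovichTemkin2026, §2.1.2 (p. 4 l. 11–16)] -/
theorem classicalUmbrella_pointBlowup_zChart (x y z : A) :
    classicalUmbrella (x * z) (y * z) z = z ^ 2 * classicalUmbrella x y z := by
  unfold classicalUmbrella; ring

/-- Kollár's fourfold example `W = V(x² − yzt) ⊂ 𝔸⁴`: "Essentially the same computation shows that the
singularity … also persists after a blowing up" — `t`-chart `(x, y, z, t) ↦ (xt, yt, zt, t)` of the point
blow-up: total transform `t² · (x² − yz·t)` (any commutative ring); the source adds: "Its singular locus
`V(x, yz, yt, zt)` is `S₃`-invariant, and the origin `p` is the only smooth `S₃`-invariant subvariety in the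
singular locus that contains `p`. Therefore there exists no functorial memoryless algorithm which blows up only
smooth centers" (not formalised). [cite: AbramovichTemkin2026, §2.1.4 (p. 4 l. 28–33), quoting Kollár 2007, Ex. 3.6.2] -/
theorem kollarFourfold_pointBlowup_tChart (x y z t : A) :
    (x * t) ^ 2 - (y * t) * (z * t) * t = t ^ 2 * (x ^ 2 - y * z * t) := by
  ring

/-- §2.1.9 WEIGHTED RESOLVABILITY IN CHARACTERISTIC `0` (identity valid in any ring): for the centre
`J = (x², y³, z³)`, "the new coordinates on the corresponding étale-local chart `Y′_z = Spec(k[x′, y′, z′])` are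
related to the old ones by `x′ = x/z′³`, `y′ = y/z′²` and `z = z′²`, so the pullback of `X` is given in by
`z′⁶(x′² − y′²)`, and the `z`-chart of the strict transform `X′_z` is given by `x′² − y′² = 0`. In particular,
the strict transform is indeed a normal crossings surface." [cite: AbramovichTemkin2026, §2.1.9 (p. 5 l. 30–40)] -/
theorem classicalUmbrella_weightedChart_z (x y t : A) :
    classicalUmbrella (x * t ^ 3) (y * t ^ 2) (t ^ 2) = t ^ 6 * (x ^ 2 - y ^ 2) := by
  unfold classicalUmbrella; ring

/-- The SAME slice `{z′ = 1}` for the inseparable umbrella: `x′² + y′²` (any ring) …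
[cite: AbramovichTemkin2026, §2.2.2 (3) (p. 7 l. 22–25)] -/
theorem inseparableUmbrella_flatSlice (x y t : A) :
    inseparableUmbrella (x * t ^ 3) (y * t ^ 2) (t ^ 2) = t ^ 6 * (x ^ 2 + y ^ 2) := by
  unfold inseparableUmbrella; ring

/-- … which in characteristic `2` is the double plane `(x′ + y′)²`: "The flat chart given by the slice
`{z′ = 1}`, where the equation is `x′² = y′²` with `μ₂` acting with weights `1` on `x′` and `0` on `y′`, is
misleading: the singularity of a `μ₂`-torsor `T` over a stack `𝒵` is typically worse than that of `𝒵`. In this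
case the invariant `(2)` of `T := {x′² = y′²}` is larger than the invariant `(2, 3, 3)` of
`𝒵 := [{x′² = y′²z′}/𝔾_m]`" (the sentence about invariants is not formalised).
[cite: AbramovichTemkin2026, §2.2.2 (3) (p. 7 l. 20–25)] -/
theorem inseparableUmbrella_flatSlice_charTwo [CharP A 2] (x y t : A) :
    inseparableUmbrella (x * t ^ 3) (y * t ^ 2) (t ^ 2) = t ^ 6 * (x + y) ^ 2 := by
  unfold inseparableUmbrella
  linear_combination (-(t ^ 6 * x * y)) * (CharTwo.two_eq_zero : (2 : A) = 0)

/-! ## All `p` at once: the `p`-umbrella `x^p + y^p z` under the centre `(x^p, y^{p+1}, z^{p+1})` (derived here)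

The inseparable umbrella is the case `p = 2` of the `p`-umbrella `x^p + y^p z` (the tree's
`WeightedBlowup.Umbrella`, file `WeightedBlowupUmbrella.lean`: translation homogeneity along the singular line
in characteristic `p`, one blow-up of the line resolves).  The coordinate centre of maximal invariant for
`x^p + y^p z` in the transplanted recipe is `(x^p, y^{p+1}, z^{p+1})` (invariant `(p, p+1, p+1)`: admissibility of
`y^p z` reads `p/c₂ + 1/c₃ ≥ 1` with `c₂ ≤ c₃`), reduced weights `(p+1, p, p)`, `ℓ = p(p+1)`; the degeneration
`x = s^{p+1}x′, y = s^p y′, z = s^p z′` REPRODUCES the equation for every `p` — the ring identity below; for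
`p = 2` it is §2.2.2 of the source. (derived here; the maximality of the centre and the invariant are NOT
formalised here — see `KangarooAtlasCertWeighted.whitney_invCoord` for `p = 2`.) -/

/-- The `p`-UMBRELLA LOOP, ring level, every `p`: `(s^{p+1}x)^p + (s^p y)^p (s^p z) = s^{p(p+1)} · (x^p + y^p z)`
(any commutative ring; `p` any natural number). (derived here; `p = 2` is the printed computation)
[cite: AbramovichTemkin2026, §2.2.2 (p. 7 l. 10–14) (the case p = 2)] -/
theorem pUmbrella_weightedTransform (p : ℕ) (s x y z : A) :
    (s ^ (p + 1) * x) ^ p + (s ^ p * y) ^ p * (s ^ p * z) = s ^ (p * (p + 1)) * (x ^ p + y ^ p * z) := by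
  ring

/-- The `p`-umbrella under the point blow-up, `z`-chart: `(xz)^p + (yz)^p z = z^p · (x^p + y^p z)` — the shape
persists for every `p` (any commutative ring). (derived here; `p = 2`: §2.1.2 / §2.3.3 of the source)
[cite: AbramovichTemkin2026, §2.3.3 (p. 8 l. 5–8) (the case p = 2)] -/
theorem pUmbrella_pointBlowup_zChart (p : ℕ) (x y z : A) :
    (x * z) ^ p + (y * z) ^ p * z = z ^ p * (x ^ p + y ^ p * z) := by
  ring

/-- `p = 2` of `pUmbrella_weightedTransform` is `inseparableUmbrella_weightedTransform`. (derived here)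
[cite: AbramovichTemkin2026, §2.2.2 (p. 7 l. 10–14)] -/
theorem inseparableUmbrella_weightedTransform' (s x y z : A) :
    inseparableUmbrella (s ^ (2 + 1) * x) (s ^ 2 * y) (s ^ 2 * z) = s ^ (2 * (2 + 1)) * inseparableUmbrella x y z := by
  unfold inseparableUmbrella; ring

end WildUmbrella

end Literature.AlgebraicGeometry.Resolution
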